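import Literature.AlgebraicGeometry.Resolution.PrincipalizationToResolution
import HarnessLib

/-!
# Route UniversalCells — crux `LocalToGlobal` (stmt-ResolutionOfSingularities-15232), line `birth`:
# the finite-cover induction (`stub_coverInduction`)

For a prime `p`: if every point of every integral separated finite-type `𝔽_p`-scheme has an open
neighbourhood admitting a resolution of singularities (pointwise Zariski-local resolvability,
`hloc`), and the union of two resolvable opens of such a scheme is resolvable (binary union,
`hbin`), then every integral separated finite-type `𝔽_p`-scheme `X` has a resolution.

Proof (Hu 2021, p. 65: "it remains to glue finitely many local resolutions"). `X` is
quasi-compact, so finitely many resolvable opens `U x₁, …, U xₙ` cover it. By induction over the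
(nonempty) finite index set, `U x₁ ∪ ⋯ ∪ U x_k` is resolvable: the step applies `hbin` to the open
subscheme `W = U a ∪ (U x₁ ∪ ⋯ ∪ U x_k)` of `X` — a nonempty open of the integral `X`, hence
integral, and separated / locally of finite type / quasi-compact over `𝔽_p` through `W ↪ X → 𝔽_p`
(`X` is Noetherian) — and to its two opens `W.ι ⁻¹ (U a)`, `W.ι ⁻¹ (U x₁ ∪ ⋯ ∪ U x_k)`, which are
resolvable because resolutions transport along the open immersions `W.ι ∣_ _`
(`Scheme.HasResolution.of_isOpenImmersion`). Finally `U x₁ ∪ ⋯ ∪ U xₙ = ⊤ ≅ X`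
(`Scheme.HasResolution.of_iso` along `X.topIso`).
-/

-- single-problem summit: the doubled namespace component `ResolutionOfSingularities` is forced
set_option linter.dupNamespace false

noncomputable section

namespace Summit.ResolutionOfSingularities.ResolutionOfSingularities.Theorems

open CategoryTheory AlgebraicGeometry TopologicalSpace Literature.AlgebraicGeometry.Resolution

/-- **Finite-cover induction** (crux `UniversalCells.LocalToGlobal`, line `birth`, stub
`stub_coverInduction`): for a prime `p`, pointwise Zariski-local resolvability of all integral
separated finite-type `𝔽_p`-schemes (`hloc`) together with resolvability of binary unions of
resolvable opens (`hbin`) gives a resolution of every integral separated finite-type `𝔽_p`-scheme: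
a finite subcover by resolvable opens (quasi-compactness) and induction on its size, the step being
`hbin` applied to the open subscheme `U a ∪ (U x₁ ∪ ⋯ ∪ U x_k)`. [cite: Hu2021, p. 65] -/
theorem stub_coverInduction (p : ℕ) (hp : p.Prime)
    (hloc : ∀ (X : Scheme.{0}) (f : X ⟶ Spec (.of (ZMod p))), IsSeparated f →
      LocallyOfFiniteType f → QuasiCompact f → IsIntegral X →
        ∀ x : X, ∃ U : X.Opens, x ∈ U ∧ Scheme.HasResolution (U : Scheme.{0}))
    (hbin : ∀ (X : Scheme.{0}) (f : X ⟶ Spec (.of (ZMod p))), IsSeparated f →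
      LocallyOfFiniteType f → QuasiCompact f → IsIntegral X → ∀ U V : X.Opens, U ⊔ V = ⊤ →
        Scheme.HasResolution (U : Scheme.{0}) → Scheme.HasResolution (V : Scheme.{0}) →
          Scheme.HasResolution X)
    (X : Scheme.{0}) (f : X ⟶ Spec (.of (ZMod p))) (hs : IsSeparated f)
    (hl : LocallyOfFiniteType f) (hq : QuasiCompact f) (hi : IsIntegral X) :
    Scheme.HasResolution X := by
  -- Noetherian / compactness bookkeeping: `X` is of finite type over the field `𝔽_p`.
  haveI : Fact p.Prime := ⟨hp⟩
  haveI : IsLocallyNoetherian X := LocallyOfFiniteType.isLocallyNoetherian f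
  haveI : CompactSpace X := QuasiCompact.compactSpace_of_compactSpace f
  -- Step 1: a resolvable open neighbourhood `U x` of every point `x`.
  choose U hxU hU using fun x => hloc X f hs hl hq hi x
  -- Step 2: binary union, iterated: every nonempty finite union of the `U x` is resolvable.
  have key : ∀ s : Finset X, s.Nonempty →
      Scheme.HasResolution ((s.sup U : X.Opens) : Scheme.{0}) := by
    intro s hsne
    induction hsne using Finset.Nonempty.cons_induction with
    | singleton a =>
      rw [Finset.sup_singleton]
      exact hU a
    | cons a t hat htne ih =>
      rw [Finset.sup_cons]
      -- the open subscheme `W = U a ∪ ⋃_{x ∈ t} U x` of `X`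
      have haW : a ∈ U a ⊔ t.sup U := Opens.mem_sup.2 (Or.inl (hxU a))
      haveI : Nonempty ((U a ⊔ t.sup U : X.Opens) : Scheme.{0}) :=
        (Scheme.Opens.nonempty_iff _).2 ⟨a, haW⟩
      haveI : IsIntegral ((U a ⊔ t.sup U : X.Opens) : Scheme.{0}) :=
        isIntegral_of_isOpenImmersion (U a ⊔ t.sup U).ι
      have hcov : (U a ⊔ t.sup U).ι ⁻¹ᵁ U a ⊔ (U a ⊔ t.sup U).ι ⁻¹ᵁ t.sup U = ⊤ := by
        rw [← Scheme.Hom.preimage_sup]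
        exact (U a ⊔ t.sup U).ι_preimage_self
      exact hbin _ ((U a ⊔ t.sup U).ι ≫ f) inferInstance inferInstance inferInstance
        inferInstance _ _ hcov ((hU a).of_isOpenImmersion ((U a ⊔ t.sup U).ι ∣_ U a))
        (ih.of_isOpenImmersion ((U a ⊔ t.sup U).ι ∣_ t.sup U))
  -- Step 3: quasi-compactness: finitely many of the `U x` cover `X`.
  obtain ⟨t, ht⟩ := isCompact_univ.elim_finite_subcover (fun x => ((U x : X.Opens) : Set X))
    (fun x => (U x).isOpen) (fun x _ => Set.mem_iUnion.2 ⟨x, hxU x⟩)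
  have htop : t.sup U = ⊤ := by
    refine top_le_iff.mp fun z _ => ?_
    obtain ⟨i, hi, hzi⟩ := Set.mem_iUnion₂.mp (ht (Set.mem_univ z))
    exact (Finset.le_sup hi : U i ≤ t.sup U) hzi
  -- `X` is nonempty (it is integral), so the subcover is nonempty.
  have htne : t.Nonempty := by
    obtain ⟨x₀⟩ := (inferInstance : Nonempty X)
    obtain ⟨i, hi, -⟩ := Set.mem_iUnion₂.mp (ht (Set.mem_univ x₀))
    exact ⟨i, hi⟩
  -- Step 4: the whole of `X`: `⊤ ≅ X`.
  have hres := key t htne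
  rw [htop] at hres
  exact hres.of_iso X.topIso.hom

end Summit.ResolutionOfSingularities.ResolutionOfSingularities.Theorems

end
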